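import Literature.MathematicalPhysics.QuantumFieldTheory.OSSkeletonVFunctional
import Literature.MathematicalPhysics.QuantumFieldTheory.OSVectorNormGrowth
import Literature.MathematicalPhysics.QuantumFieldTheory.SchwartzTensorNorms
import Literature.MathematicalPhysics.QuantumFieldTheory.OSLogSlotAnalyticity
import Literature.Analysis.Complex.FlatTubeFourierFamily
import Literature.Analysis.Distribution.KernelScaling
import Literature.Analysis.FunctionSpaces.SchwartzCompEquivBound
import Literature.Analysis.FunctionSpaces.SchwartzParametric
import HarnessLib

/-!
# Profile-uniform bounds for the directional skeleton and its slot functions (OS II, Ch. VI.1, the E0' input)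

Topic `Literature/MathematicalPhysics/QuantumFieldTheory`; supplement to `OSSkeletonVFunctional`. The
tree's bounds `exists_norm_skelSV_le`, `exists_norm_slotExtV_le` are existential in the profiles
`φⱼ`; the removal of the regularisation (Osterwalder–Schrader II, Ch. VI.1: the constants of
(6.12)–(6.13) are powers of the inverse width of the regularising kernels, "bounds on `‖Ψ₁‖` follow
from E0'") needs them **uniform in the profiles, polynomial in their Schwartz norms**. This file
supplies that bookkeeping:

* `schwartzNorm_rotOne_le`, `schwartzNorm_reflectOne_le` — frames and reflections do not increase
  the Schwartz norms of a profile;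
* `schwartzNorm_skeletonFnV_tensorFin_le` — the norm of a skeleton cluster `⊗ⱼ ψⱼ(· − pⱼ)` is at most
  `2^{M+1} (1 + ‖p‖)^M (2^{M+1})^n ∏ⱼ |ψⱼ|_M`;
* `schwartzNorm_leftGenV_le`, `schwartzNorm_rightGenV_le` — the generators of the slot `(i, μ)`
  through `∏ⱼ |φⱼ|_M` and `(1 + ‖u‖)^M`;
* `norm_slotExtV_le_of_vectorBound` — **the slot functions through the profiles**: given a uniform
  E0' vector bound `‖v(K)‖ ≤ C_n |K|_{2ns}` (`OSVectorNormGrowth.exists_norm_ι_δ_le_of_hasLinearGrowth`),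
  `‖slotExtV u τ‖ ≤ (explicit) · (∏ⱼ |φⱼ|_M)² · (1 + ‖u‖)^{2M}`, `M = 2(k+1)s`;
* `norm_skelSV_le_of_bound` — the skeleton itself through a temperedness bound of `𝔖_{k+2}`.

## References

* K. Osterwalder, R. Schrader, *Axioms for Euclidean Green's functions II*, Comm. Math. Phys.
  42 (1975) 281–305, Ch. VI.1 (6.12)–(6.13), (6.17)–(6.18). [OsterwalderSchraderCMP1975]
-/

noncomputable section

open MeasureTheory Set Filter
open _root_.Topology
open scoped InnerProductSpace RealInnerProductSpace NNReal ComplexConjugate SchwartzMap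

namespace Literature.MathematicalPhysics.QuantumFieldTheory

variable {d : ℕ}

open Literature.MathematicalPhysics.QuantumLattice (SchwingerFamily IsPositiveTimeMulti schwartzNorm)
open Literature.MathematicalPhysics.QuantumLattice.SchwingerFamily
open Literature.MathematicalPhysics.QuantumLattice.SchwingerFamily.OSSpace
open OSFrames

/-! ### Profiles: frames and reflections do not increase Schwartz norms -/

/-- Frames: `p_{k,l}(ψ ∘ L⁻¹) ≤ p_{k,l}(ψ)` for a linear isometry `L`. [folklore] -/
theorem seminorm_rotOne_le (L : EuclideanSpace ℝ (Fin d) ≃ₗᵢ[ℝ] EuclideanSpace ℝ (Fin d))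
    (ψ : 𝓢(EuclideanSpace ℝ (Fin d), ℂ)) (k l : ℕ) :
    SchwartzMap.seminorm ℂ k l (rotOne L ψ) ≤ SchwartzMap.seminorm ℂ k l ψ := by
  refine SchwartzMap.seminorm_le_bound ℂ k l _ (apply_nonneg _ _) fun x => ?_
  have hfun : (⇑(rotOne L ψ) : EuclideanSpace ℝ (Fin d) → ℂ) = (ψ : EuclideanSpace ℝ (Fin d) → ℂ) ∘ L.symm := by
    funext y; simp
  rw [hfun, L.symm.norm_iteratedFDeriv_comp_right, ← L.symm.norm_map x]
  exact SchwartzMap.le_seminorm ℂ k l ψ _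

/-- Frames: `|ψ ∘ L⁻¹|_M ≤ |ψ|_M`. [folklore] -/
theorem schwartzNorm_rotOne_le (L : EuclideanSpace ℝ (Fin d) ≃ₗᵢ[ℝ] EuclideanSpace ℝ (Fin d))
    (ψ : 𝓢(EuclideanSpace ℝ (Fin d), ℂ)) (M : ℕ) : schwartzNorm M (rotOne L ψ) ≤ schwartzNorm M ψ := by
  change ((Finset.Iic (M, M)).sup (schwartzSeminormFamily ℂ _ ℂ)) (rotOne L ψ) ≤ _
  refine Seminorm.finset_sup_apply_le (QuantumLattice.schwartzNorm_nonneg M ψ) fun q hq => ?_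
  rw [Finset.mem_Iic] at hq
  rw [SchwartzMap.schwartzSeminormFamily_apply]
  exact (seminorm_rotOne_le L ψ q.1 q.2).trans (QuantumLattice.seminorm_le_schwartzNorm hq.1 hq.2 ψ)

section Reflect

variable [NeZero d]

/-- Reflections: `p_{k,l}(conj (ψ ∘ θ)) ≤ p_{k,l}(ψ)`. [folklore] -/
theorem seminorm_reflectOne_le (ψ : 𝓢(EuclideanSpace ℝ (Fin d), ℂ)) (k l : ℕ) :
    SchwartzMap.seminorm ℂ k l (reflectOne ψ) ≤ SchwartzMap.seminorm ℂ k l ψ := by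
  refine SchwartzMap.seminorm_le_bound ℂ k l _ (apply_nonneg _ _) fun x => ?_
  have hfun : (⇑(reflectOne ψ) : EuclideanSpace ℝ (Fin d) → ℂ) =
      Complex.conjLIE ∘ ((ψ : EuclideanSpace ℝ (Fin d) → ℂ) ∘ QuantumLattice.timeReflection d) := by
    funext y; simp
  rw [hfun, Complex.conjLIE.norm_iteratedFDeriv_comp_left,
    (QuantumLattice.timeReflection d).norm_iteratedFDeriv_comp_right, ← (QuantumLattice.timeReflection d).norm_map x]
  exact SchwartzMap.le_seminorm ℂ k l ψ _

/-- Reflections: `|conj (ψ ∘ θ)|_M ≤ |ψ|_M`. [folklore] -/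
theorem schwartzNorm_reflectOne_le (ψ : 𝓢(EuclideanSpace ℝ (Fin d), ℂ)) (M : ℕ) :
    schwartzNorm M (reflectOne ψ) ≤ schwartzNorm M ψ := by
  change ((Finset.Iic (M, M)).sup (schwartzSeminormFamily ℂ _ ℂ)) (reflectOne ψ) ≤ _
  refine Seminorm.finset_sup_apply_le (QuantumLattice.schwartzNorm_nonneg M ψ) fun q hq => ?_
  rw [Finset.mem_Iic] at hq
  rw [SchwartzMap.schwartzSeminormFamily_apply]
  exact (seminorm_reflectOne_le ψ q.1 q.2).trans (QuantumLattice.seminorm_le_schwartzNorm hq.1 hq.2 ψ)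

end Reflect

/-! ### Clusters: the norm of a skeleton cluster through the profiles -/

/-- **Schwartz norm of a cluster at vector positions**:
`|skeletonFnV Φ₀ p|_M ≤ 2^{M+1} (1 + ‖p‖)^M |Φ₀|_M`. [folklore] -/
theorem schwartzNorm_skeletonFnV_le {K : ℕ} (Φ₀ : 𝓢((Fin K → EuclideanSpace ℝ (Fin d)), ℂ))
    (p : Fin K → EuclideanSpace ℝ (Fin d)) (M : ℕ) :
    schwartzNorm M (skeletonFnV Φ₀ p) ≤ 2 ^ (M + 1) * (1 + ‖p‖) ^ M * schwartzNorm M Φ₀ := by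
  change ((Finset.Iic (M, M)).sup (schwartzSeminormFamily ℂ _ ℂ)) (skeletonFnV Φ₀ p) ≤ _
  have h0 := QuantumLattice.schwartzNorm_nonneg M Φ₀
  refine Seminorm.finset_sup_apply_le (by positivity) fun q hq => ?_
  rw [Finset.mem_Iic] at hq
  rw [SchwartzMap.schwartzSeminormFamily_apply]
  refine (seminorm_skeletonFnV_le Φ₀ q.1 q.2 p).trans ?_
  have h1 : (2 : ℝ) ^ q.1 ≤ 2 ^ M := pow_le_pow_right₀ (by norm_num) hq.1
  have h2 : (1 + ‖p‖) ^ q.1 ≤ (1 + ‖p‖) ^ M := pow_le_pow_right₀ (by linarith [norm_nonneg p]) hq.1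
  have h3 : SchwartzMap.seminorm ℂ q.1 q.2 Φ₀ + SchwartzMap.seminorm ℂ 0 q.2 Φ₀ ≤ 2 * schwartzNorm M Φ₀ := by
    have ha := QuantumLattice.seminorm_le_schwartzNorm hq.1 hq.2 Φ₀
    have hb := QuantumLattice.seminorm_le_schwartzNorm (Nat.zero_le M) hq.2 Φ₀
    linarith
  have h4 : 0 ≤ SchwartzMap.seminorm ℂ q.1 q.2 Φ₀ + SchwartzMap.seminorm ℂ 0 q.2 Φ₀ := by positivity
  calc 2 ^ q.1 * (1 + ‖p‖) ^ q.1 * (SchwartzMap.seminorm ℂ q.1 q.2 Φ₀ + SchwartzMap.seminorm ℂ 0 q.2 Φ₀)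
      ≤ 2 ^ M * (1 + ‖p‖) ^ M * (2 * schwartzNorm M Φ₀) := by gcongr
    _ = 2 ^ (M + 1) * (1 + ‖p‖) ^ M * schwartzNorm M Φ₀ := by rw [pow_succ]; ring

/-- **Schwartz norm of a skeleton cluster of one-point profiles**:
`|skeletonFnV (⊗ⱼ ψⱼ) p|_M ≤ 2^{M+1} (1 + ‖p‖)^M (2^{M+1})ⁿ ∏ⱼ |ψⱼ|_M`. [folklore] -/
theorem schwartzNorm_skeletonFnV_tensorFin_le {n : ℕ} (ψ : Fin n → 𝓢(EuclideanSpace ℝ (Fin d), ℂ))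
    (p : Fin n → EuclideanSpace ℝ (Fin d)) (M : ℕ) :
    schwartzNorm M (skeletonFnV (SchwartzMap.tensorFin n ψ) p) ≤
      2 ^ (M + 1) * (1 + ‖p‖) ^ M * ((2 ^ (M + 1)) ^ n * ∏ j, schwartzNorm M (ψ j)) :=
  (schwartzNorm_skeletonFnV_le _ p M).trans
    (mul_le_mul_of_nonneg_left (schwartzNorm_tensorFin_le ψ M) (by positivity))

/-! ### Generators of a slot: norms through the profiles -/

section Generators

variable [NeZero d] {k : ℕ} (φ : Fin (k + 2) → 𝓢(EuclideanSpace ℝ (Fin d), ℂ))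
  (ξ : Fin (k + 1) → EuclideanSpace ℝ (Fin d)) (ê : Fin d → EuclideanSpace ℝ (Fin d))
  (i : Fin (k + 1)) (μ : Fin d) (g : ℝ)

/-- The affine constant of the anchored frame positions:
`1 + ‖qⱼ(u)‖ ≤ slotPosConst · (1 + ‖u‖)` (`one_add_norm_framePos_le`). [folklore] -/
def slotPosConst : ℝ := 2 * ((k + 1) * ‖ξ‖) + |g| / 2 + 1 + 2 * ((k + 1) * ∑ ν, ‖ê ν‖)

omit [NeZero d] in
/-- `1 ≤ slotPosConst`. [folklore] -/
theorem one_le_slotPosConst : 1 ≤ slotPosConst ξ ê g := by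
  unfold slotPosConst
  have h1 : 0 ≤ (k + 1 : ℝ) * ‖ξ‖ := by positivity
  have h2 : 0 ≤ (k + 1 : ℝ) * ∑ ν, ‖ê ν‖ := by positivity
  linarith [abs_nonneg g]

/-- **Affine bound of the anchored frame positions**: `1 + ‖qⱼ(u)‖ ≤ slotPosConst · (1 + ‖u‖)`. [folklore] -/
theorem one_add_norm_framePos_le (u : Fin (k + 1) × Fin d → ℝ) (j : Fin (k + 2)) :
    1 + ‖framePos i μ ξ ê g u j‖ ≤ slotPosConst ξ ê g * (1 + ‖u‖) := by
  have h := norm_framePos_le ξ ê i μ g u j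
  unfold slotPosConst
  have h1 : 0 ≤ (k + 1 : ℝ) * ‖ξ‖ := by positivity
  have h2 : 0 ≤ (k + 1 : ℝ) * ∑ ν, ‖ê ν‖ := by positivity
  have h3 : 0 ≤ ‖u‖ := norm_nonneg u
  nlinarith [abs_nonneg g, mul_nonneg h1 h3, mul_nonneg h2 h3, mul_nonneg (abs_nonneg g) h3]

/-- The relabelled anchored positions of a sub-cluster obey the same affine bound. [folklore] -/
theorem one_add_norm_framePos_comp_le {n : ℕ} (u : Fin (k + 1) × Fin d → ℝ) (e : Fin n → Fin (k + 2))
    (c : EuclideanSpace ℝ (Fin d)) (hc : c = 0) :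
    1 + ‖fun j => framePos i μ ξ ê g u (e j) - c‖ ≤ slotPosConst ξ ê g * (1 + ‖u‖) := by
  subst hc
  have h0 : 0 ≤ slotPosConst ξ ê g * (1 + ‖u‖) - 1 := by
    have h1 := one_le_slotPosConst ξ ê g
    nlinarith [norm_nonneg u]
  have h := (pi_norm_le_iff_of_nonneg h0).2 fun j => show ‖framePos i μ ξ ê g u (e j) - 0‖ ≤ _ by
    rw [sub_zero]; linarith [one_add_norm_framePos_le ξ ê i μ g u (e j)]
  linarith

/-- **Schwartz norm of the left generator through the profiles**:
`|P_{iμ}(u)|_M ≤ 2^{M+1} (slotPosConst (1 + ‖u‖))^M (2^{M+1})^{n_L} ∏_{j < n_L} |φⱼ|_M`. [folklore] -/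
theorem schwartzNorm_leftGenV_le (M : ℕ) (u : Fin (k + 1) × Fin d → ℝ) :
    schwartzNorm M (leftGenV i μ φ ξ ê g u) ≤
      2 ^ (M + 1) * (slotPosConst ξ ê g * (1 + ‖u‖)) ^ M *
        ((2 ^ (M + 1)) ^ nL i * ∏ j : Fin (nL i), schwartzNorm M (φ (Fin.cast (nL_add_nR i) (Fin.castAdd (nR i) j)))) := by
  unfold leftGenV leftGenFnV
  refine (schwartzNorm_osAdjoint_le _ M).trans ((schwartzNorm_skeletonFnV_tensorFin_le _ _ M).trans ?_)
  have hP := one_add_norm_framePos_comp_le ξ ê i μ g u (fun j : Fin (nL i) => Fin.cast (nL_add_nR i) (Fin.castAdd (nR i) j)) 0 rfl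
  simp only [sub_zero] at hP
  have h0 : ∀ j : Fin (nL i), 0 ≤ schwartzNorm M (φrot i μ φ ê (Fin.castAdd (nR i) j)) := fun j =>
    QuantumLattice.schwartzNorm_nonneg _ _
  have hrot : ∏ j : Fin (nL i), schwartzNorm M (φrot i μ φ ê (Fin.castAdd (nR i) j)) ≤
      ∏ j : Fin (nL i), schwartzNorm M (φ (Fin.cast (nL_add_nR i) (Fin.castAdd (nR i) j))) :=
    Finset.prod_le_prod (fun j _ => h0 j) fun j _ => schwartzNorm_rotOne_le _ _ M
  have hprod0 : 0 ≤ ∏ j : Fin (nL i), schwartzNorm M (φrot i μ φ ê (Fin.castAdd (nR i) j)) :=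
    Finset.prod_nonneg fun j _ => h0 j
  have hS0 : 0 ≤ slotPosConst ξ ê g * (1 + ‖u‖) :=
    mul_nonneg (zero_le_one.trans (one_le_slotPosConst ξ ê g)) (by positivity)
  have hc0 : (0 : ℝ) ≤ 2 ^ (M + 1) * (slotPosConst ξ ê g * (1 + ‖u‖)) ^ M := by positivity
  gcongr

/-- **Schwartz norm of the right generator through the profiles**:
`|R_{iμ}(u)|_M ≤ 2^{M+1} (slotPosConst (1 + ‖u‖))^M (2^{M+1})^{n_R} ∏_{j ≥ n_L} |φⱼ|_M`. [folklore] -/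
theorem schwartzNorm_rightGenV_le (M : ℕ) (u : Fin (k + 1) × Fin d → ℝ) :
    schwartzNorm M (rightGenV i μ φ ξ ê g u) ≤
      2 ^ (M + 1) * (slotPosConst ξ ê g * (1 + ‖u‖)) ^ M *
        ((2 ^ (M + 1)) ^ nR i * ∏ j : Fin (nR i), schwartzNorm M (φ (Fin.cast (nL_add_nR i) (Fin.natAdd (nL i) j)))) := by
  unfold rightGenV rightGenFnV
  refine (schwartzNorm_skeletonFnV_tensorFin_le _ _ M).trans ?_
  have hP := one_add_norm_framePos_comp_le ξ ê i μ g u (fun j : Fin (nR i) => Fin.cast (nL_add_nR i) (Fin.natAdd (nL i) j))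
    (timeVec 0) timeVec_zero
  have h0 : ∀ j : Fin (nR i), 0 ≤ schwartzNorm M (φrot i μ φ ê (Fin.natAdd (nL i) j)) := fun j =>
    QuantumLattice.schwartzNorm_nonneg _ _
  have hrot : ∏ j : Fin (nR i), schwartzNorm M (φrot i μ φ ê (Fin.natAdd (nL i) j)) ≤
      ∏ j : Fin (nR i), schwartzNorm M (φ (Fin.cast (nL_add_nR i) (Fin.natAdd (nL i) j))) :=
    Finset.prod_le_prod (fun j _ => h0 j) fun j _ => schwartzNorm_rotOne_le _ _ M
  have hprod0 : 0 ≤ ∏ j : Fin (nR i), schwartzNorm M (φrot i μ φ ê (Fin.natAdd (nL i) j)) :=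
    Finset.prod_nonneg fun j _ => h0 j
  have hS0 : 0 ≤ slotPosConst ξ ê g * (1 + ‖u‖) :=
    mul_nonneg (zero_le_one.trans (one_le_slotPosConst ξ ê g)) (by positivity)
  have hc0 : (0 : ℝ) ≤ 2 ^ (M + 1) * (slotPosConst ξ ê g * (1 + ‖u‖)) ^ M := by positivity
  gcongr

/-- The product of profile norms over the left and the right sub-cluster is the product over all
profiles. [folklore] -/
theorem prod_left_mul_prod_right (f : Fin (k + 2) → ℝ) :
    (∏ j : Fin (nL i), f (Fin.cast (nL_add_nR i) (Fin.castAdd (nR i) j))) *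
        ∏ j : Fin (nR i), f (Fin.cast (nL_add_nR i) (Fin.natAdd (nL i) j)) = ∏ j, f j := by
  rw [← Fin.prod_univ_add (fun J : Fin (nL i + nR i) => f (Fin.cast (nL_add_nR i) J))]
  exact Fintype.prod_equiv (finCongr (nL_add_nR i)) _ _ fun J => rfl

end Generators

/-! ### The slot functions through the profiles (E0') -/

section SlotExt

variable [NeZero d] (𝔖 : SchwingerFamily (EuclideanSpace ℝ (Fin d))) (hE1 : 𝔖.IsEuclideanCovariant)
  (hE2 : 𝔖.IsOSReflectionPositive) {k : ℕ} (φ : Fin (k + 2) → 𝓢(EuclideanSpace ℝ (Fin d), ℂ))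
  (ξ : Fin (k + 1) → EuclideanSpace ℝ (Fin d)) (ê : Fin d → EuclideanSpace ℝ (Fin d))
  (i : Fin (k + 1)) (μ : Fin d) {g r : ℝ}
  (hφ : ∀ j, tsupport (φ j : EuclideanSpace ℝ (Fin d) → ℂ) ⊆ Metric.closedBall 0 r)
  (hê1 : ‖ê μ‖ = 1) (hêê : ∀ ν, 0 ≤ ⟪ê μ, ê ν⟫) (hξ : ∀ i', g ≤ ⟪ê μ, ξ i'⟫)
  (hg : 2 * r < g) (hr : 0 ≤ r)

/-- **The slot functions through the profiles, uniformly on `{Re τ ≥ 0}`** (Osterwalder–Schrader II,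
Ch. VI.1: "bounds on `‖Ψ₁(…)‖` follow from E0'"): given a uniform E0' vector bound
`‖v(K)‖ ≤ C_n |K|_{2ns}` for positive-time `n`-point `K` (`exists_norm_ι_δ_le_of_hasLinearGrowth`) and
`M ≥ 2 n_L s, 2 n_R s`,
`‖slotExtV u τ‖ ≤ C_{n_L} C_{n_R} (2^{M+1})² (2^{M+1})^{k+2} slotPosConst^{2M} (∏ⱼ |φⱼ|_M) (1 + ‖u‖)^{2M}`.
[cite: OsterwalderSchraderCMP1975, Ch. VI.1 p. 297 and (6.13)] -/
theorem norm_slotExtV_le_of_vectorBound {s : ℕ} {Cv : ℕ → ℝ} (hCv : ∀ n, 0 ≤ Cv n)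
    (hv : ∀ (n : ℕ) (K : 𝓢((Fin n → EuclideanSpace ℝ (Fin d)), ℂ)) (hK : IsPositiveTimeMulti K),
      ‖ι 𝔖 hE2 (δ 𝔖 hE2 (mkGen K hK))‖ ≤ Cv n * schwartzNorm ((n + n) * s) K)
    {M : ℕ} (hML : (nL i + nL i) * s ≤ M) (hMR : (nR i + nR i) * s ≤ M)
    (u : Fin (k + 1) × Fin d → ℝ) {τ : ℂ} (hτ : 0 ≤ τ.re) :
    ‖slotExtV 𝔖 hE1 hE2 φ ξ ê i μ hφ hê1 hêê hξ hg hr u τ‖ ≤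
      Cv (nL i) * Cv (nR i) * ((2 ^ (M + 1)) ^ 2 * (2 ^ (M + 1)) ^ (k + 2) * slotPosConst ξ ê g ^ (M + M)) *
        (∏ j, schwartzNorm M (φ j)) * (1 + ‖u‖) ^ (M + M) := by
  refine (norm_gapContinuation_le _ _ hτ).trans ?_
  set PL : ℝ := ∏ j : Fin (nL i), schwartzNorm M (φ (Fin.cast (nL_add_nR i) (Fin.castAdd (nR i) j))) with hPL
  set PR : ℝ := ∏ j : Fin (nR i), schwartzNorm M (φ (Fin.cast (nL_add_nR i) (Fin.natAdd (nL i) j))) with hPR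
  have hPL0 : 0 ≤ PL := Finset.prod_nonneg fun j _ => QuantumLattice.schwartzNorm_nonneg _ _
  have hPR0 : 0 ≤ PR := Finset.prod_nonneg fun j _ => QuantumLattice.schwartzNorm_nonneg _ _
  have hS0 : 0 ≤ slotPosConst ξ ê g * (1 + ‖u‖) :=
    mul_nonneg (zero_le_one.trans (one_le_slotPosConst ξ ê g)) (by positivity)
  have hL : ‖δ 𝔖 hE2 (mkGen (leftGenV i μ φ ξ ê g (absParams u))
        (isPositiveTimeMulti_leftGenV hφ hê1 hêê hξ hg hr (absParams_nonneg u)))‖ ≤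
      Cv (nL i) * (2 ^ (M + 1) * (slotPosConst ξ ê g * (1 + ‖u‖)) ^ M * ((2 ^ (M + 1)) ^ nL i * PL)) := by
    rw [← norm_ι]
    refine (hv _ _ _).trans (mul_le_mul_of_nonneg_left ?_ (hCv _))
    refine (QuantumLattice.schwartzNorm_mono hML _).trans ?_
    have h := schwartzNorm_leftGenV_le φ ξ ê i μ g M (absParams u)
    rwa [norm_absParams] at h
  have hR : ‖δ 𝔖 hE2 (mkGen (rightGenV i μ φ ξ ê g (absParams u))
        (isPositiveTimeMulti_rightGenV hφ hê1 hêê hξ hg hr (absParams_nonneg u)))‖ ≤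
      Cv (nR i) * (2 ^ (M + 1) * (slotPosConst ξ ê g * (1 + ‖u‖)) ^ M * ((2 ^ (M + 1)) ^ nR i * PR)) := by
    rw [← norm_ι]
    refine (hv _ _ _).trans (mul_le_mul_of_nonneg_left ?_ (hCv _))
    refine (QuantumLattice.schwartzNorm_mono hMR _).trans ?_
    have h := schwartzNorm_rightGenV_le φ ξ ê i μ g M (absParams u)
    rwa [norm_absParams] at h
  have hprod : PL * PR = ∏ j, schwartzNorm M (φ j) := by
    rw [hPL, hPR]; exact prod_left_mul_prod_right i fun j => schwartzNorm M (φ j)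
  have hpow : ((2 : ℝ) ^ (M + 1)) ^ nL i * (2 ^ (M + 1)) ^ nR i = (2 ^ (M + 1)) ^ (k + 2) := by
    rw [← pow_add, nL_add_nR]
  calc ‖δ 𝔖 hE2 (mkGen (leftGenV i μ φ ξ ê g (absParams u)) _)‖ *
        ‖δ 𝔖 hE2 (mkGen (rightGenV i μ φ ξ ê g (absParams u)) _)‖
      ≤ (Cv (nL i) * (2 ^ (M + 1) * (slotPosConst ξ ê g * (1 + ‖u‖)) ^ M * ((2 ^ (M + 1)) ^ nL i * PL))) *
          (Cv (nR i) * (2 ^ (M + 1) * (slotPosConst ξ ê g * (1 + ‖u‖)) ^ M * ((2 ^ (M + 1)) ^ nR i * PR))) :=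
        mul_le_mul hL hR (norm_nonneg _) (by have := hCv (nL i); positivity)
    _ = Cv (nL i) * Cv (nR i) * ((2 ^ (M + 1)) ^ 2 * ((2 ^ (M + 1)) ^ nL i * (2 ^ (M + 1)) ^ nR i) *
          slotPosConst ξ ê g ^ (M + M)) * (PL * PR) * (1 + ‖u‖) ^ (M + M) := by
        rw [mul_pow, pow_add, pow_add]; ring
    _ = _ := by rw [hprod, hpow]

end SlotExt

/-! ### The skeleton through the profiles (temperedness) -/

section Skeleton

variable (𝔖 : SchwingerFamily (EuclideanSpace ℝ (Fin d))) {k : ℕ}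
  (φ : Fin (k + 2) → 𝓢(EuclideanSpace ℝ (Fin d), ℂ)) (ξ : Fin (k + 1) → EuclideanSpace ℝ (Fin d))
  (ê : Fin d → EuclideanSpace ℝ (Fin d))

/-- The affine constant of the skeleton positions: `1 + ‖p(u)‖ ≤ skelPosConst · (1 + ‖u‖)`. [folklore] -/
def skelPosConst : ℝ := 1 + (k + 1) * (‖ξ‖ + ∑ μ, ‖ê μ‖)

/-- `1 + ‖p(u)‖ ≤ skelPosConst (1 + ‖u‖)`. [folklore] -/
theorem one_add_norm_posV_le (u : Fin (k + 1) × Fin d → ℝ) :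
    1 + ‖posV ξ ê u‖ ≤ skelPosConst ξ ê * (1 + ‖u‖) := by
  have h := norm_posV_le ξ ê u
  unfold skelPosConst
  have hE : 0 ≤ ∑ μ, ‖ê μ‖ := Finset.sum_nonneg fun μ _ => norm_nonneg _
  nlinarith [norm_nonneg u, norm_nonneg ξ, mul_nonneg hE (norm_nonneg u),
    mul_nonneg (by positivity : (0 : ℝ) ≤ k + 1) (norm_nonneg ξ),
    mul_nonneg (by positivity : (0 : ℝ) ≤ k + 1) (mul_nonneg hE (norm_nonneg u)),
    mul_nonneg (by positivity : (0 : ℝ) ≤ k + 1) (mul_nonneg (norm_nonneg ξ) (norm_nonneg u))]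

/-- **The skeleton Schwinger function through the profiles**: from a temperedness bound
`‖𝔖_{k+2} F‖ ≤ C₀ |F|_{s₀}`,
`|𝒮(u)| ≤ C₀ 2^{s₀+1} (2^{s₀+1})^{k+2} skelPosConst^{s₀} (∏ⱼ |φⱼ|_{s₀}) (1 + ‖u‖)^{s₀}`. [folklore] -/
theorem norm_skelSV_le_of_bound {s₀ : ℕ} {C₀ : ℝ} (hC₀ : 0 ≤ C₀)
    (hσ : ∀ F : 𝓢((Fin (k + 2) → EuclideanSpace ℝ (Fin d)), ℂ), ‖𝔖 (k + 2) F‖ ≤ C₀ * schwartzNorm s₀ F)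
    (u : Fin (k + 1) × Fin d → ℝ) :
    ‖skelSV 𝔖 φ ξ ê u‖ ≤ C₀ * (2 ^ (s₀ + 1) * (2 ^ (s₀ + 1)) ^ (k + 2) * skelPosConst ξ ê ^ s₀) *
      (∏ j, schwartzNorm s₀ (φ j)) * (1 + ‖u‖) ^ s₀ := by
  unfold skelSV
  refine (hσ _).trans ?_
  have hP0 : 0 ≤ ∏ j, schwartzNorm s₀ (φ j) := Finset.prod_nonneg fun j _ => QuantumLattice.schwartzNorm_nonneg _ _
  have h1 := one_add_norm_posV_le ξ ê u
  calc C₀ * schwartzNorm s₀ (skeletonFnV (SchwartzMap.tensorFin (k + 2) φ) (posV ξ ê u))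
      ≤ C₀ * (2 ^ (s₀ + 1) * (1 + ‖posV ξ ê u‖) ^ s₀ * ((2 ^ (s₀ + 1)) ^ (k + 2) * ∏ j, schwartzNorm s₀ (φ j))) :=
        mul_le_mul_of_nonneg_left (schwartzNorm_skeletonFnV_tensorFin_le φ _ s₀) hC₀
    _ ≤ C₀ * (2 ^ (s₀ + 1) * (skelPosConst ξ ê * (1 + ‖u‖)) ^ s₀ * ((2 ^ (s₀ + 1)) ^ (k + 2) * ∏ j, schwartzNorm s₀ (φ j))) := by
        gcongr
    _ = _ := by rw [mul_pow]; ring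

end Skeleton

/-! ### Scaled kernels: Schwartz norms and continuity in the scale -/

section Scale

open Literature.Analysis.Distribution Module

variable {V : Type*} [NormedAddCommGroup V] [InnerProductSpace ℝ V]

/-- `(invDilation hw)⁻¹ y = w • y`. [folklore] -/
theorem invDilation_symm_apply {w : ℝ} (hw : w ≠ 0) (y : V) : (invDilation hw).symm y = w • y := by
  have h := (invDilation (V := V) hw).apply_symm_apply y
  rw [invDilation_apply] at h
  calc (invDilation hw).symm y = w • (w⁻¹ • (invDilation hw).symm y) := by
        rw [smul_smul, mul_inv_cancel₀ hw, one_smul]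
    _ = w • y := by rw [h]

/-- `‖invDilation hw‖ ≤ |w|⁻¹`. [folklore] -/
theorem norm_invDilation_le {w : ℝ} (hw : w ≠ 0) :
    ‖((invDilation hw : V ≃L[ℝ] V) : V →L[ℝ] V)‖ ≤ |w|⁻¹ :=
  ContinuousLinearMap.opNorm_le_bound _ (by positivity) fun y => by
    rw [ContinuousLinearEquiv.coe_coe, invDilation_apply, norm_smul, norm_inv, Real.norm_eq_abs]

/-- `‖(invDilation hw)⁻¹‖ ≤ |w|`. [folklore] -/
theorem norm_invDilation_symm_le {w : ℝ} (hw : w ≠ 0) :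
    ‖(((invDilation hw).symm : V ≃L[ℝ] V) : V →L[ℝ] V)‖ ≤ |w| :=
  ContinuousLinearMap.opNorm_le_bound _ (abs_nonneg _) fun y => by
    rw [ContinuousLinearEquiv.coe_coe, invDilation_symm_apply, norm_smul, Real.norm_eq_abs]

/-- **Seminorms of a scaled kernel**: `p_{k,n}(N_w) ≤ w^{-(m+n)} p_{k,n}(N)` for `0 < w ≤ 1`,
`m = dim V`. [folklore] -/
theorem seminorm_scaleKernel_le {w : ℝ} (hw0 : 0 < w) (hw1 : w ≤ 1) (N : 𝓢(V, ℂ)) (k n : ℕ) :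
    SchwartzMap.seminorm ℂ k n (scaleKernel w N) ≤ (w ^ (finrank ℝ V + n))⁻¹ * SchwartzMap.seminorm ℂ k n N := by
  rw [scaleKernel, dif_neg hw0.ne', ← seminorm_real_eq, map_smul_eq_mul, Real.norm_eq_abs,
    abs_of_pos (by positivity), pow_add, mul_inv, mul_assoc]
  refine mul_le_mul_of_nonneg_left ?_ (by positivity)
  have hfg : SchwartzMap.compCLMOfContinuousLinearEquiv ℂ (invDilation hw0.ne') N =
      SchwartzMap.compCLMOfContinuousLinearEquiv ℝ (invDilation hw0.ne') N := by
    ext y; simp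
  rw [hfg, ← seminorm_real_eq k n N]
  refine (Literature.Analysis.FunctionSpaces.seminorm_compCLMOfContinuousLinearEquiv_le _ N k n).trans ?_
  have h1 : ‖(((invDilation hw0.ne').symm : V ≃L[ℝ] V) : V →L[ℝ] V)‖ ^ k ≤ 1 :=
    pow_le_one₀ (norm_nonneg _) ((norm_invDilation_symm_le hw0.ne').trans (by rwa [abs_of_pos hw0]))
  have h2 : ‖((invDilation hw0.ne' : V ≃L[ℝ] V) : V →L[ℝ] V)‖ ^ n ≤ (w ^ n)⁻¹ := by
    rw [← inv_pow]
    exact pow_le_pow_left₀ (norm_nonneg _) ((norm_invDilation_le hw0.ne').trans (by rw [abs_of_pos hw0])) n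
  have h0 : 0 ≤ SchwartzMap.seminorm ℝ k n N := apply_nonneg _ _
  calc ‖(((invDilation hw0.ne').symm : V ≃L[ℝ] V) : V →L[ℝ] V)‖ ^ k *
        ‖((invDilation hw0.ne' : V ≃L[ℝ] V) : V →L[ℝ] V)‖ ^ n * SchwartzMap.seminorm ℝ k n N
      ≤ 1 * (w ^ n)⁻¹ * SchwartzMap.seminorm ℝ k n N := by gcongr
    _ = (w ^ n)⁻¹ * SchwartzMap.seminorm ℝ k n N := by rw [one_mul]

/-- **Schwartz norms of a scaled kernel**: `|N_w|_M ≤ w^{-(m+M)} |N|_M` for `0 < w ≤ 1`, `m = dim V`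
(the inverse powers of the width in Osterwalder–Schrader II (6.12)–(6.13)). [cite: OsterwalderSchraderCMP1975, Ch. VI.1 (6.12)] -/
theorem schwartzNorm_scaleKernel_le {w : ℝ} (hw0 : 0 < w) (hw1 : w ≤ 1) (N : 𝓢(V, ℂ)) (M : ℕ) :
    schwartzNorm M (scaleKernel w N) ≤ (w ^ (finrank ℝ V + M))⁻¹ * schwartzNorm M N := by
  change ((Finset.Iic (M, M)).sup (schwartzSeminormFamily ℂ _ ℂ)) (scaleKernel w N) ≤ _
  have hN0 := QuantumLattice.schwartzNorm_nonneg M N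
  refine Seminorm.finset_sup_apply_le (by positivity) fun q hq => ?_
  rw [Finset.mem_Iic] at hq
  rw [SchwartzMap.schwartzSeminormFamily_apply]
  refine (seminorm_scaleKernel_le hw0 hw1 N q.1 q.2).trans ?_
  have h1 : (w ^ (finrank ℝ V + q.2))⁻¹ ≤ (w ^ (finrank ℝ V + M))⁻¹ := by
    rw [inv_le_inv₀ (by positivity) (by positivity)]
    exact pow_le_pow_of_le_one hw0.le hw1 (by have := hq.2; omega)
  exact mul_le_mul h1 (QuantumLattice.seminorm_le_schwartzNorm hq.1 hq.2 N) (apply_nonneg _ _) (by positivity)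

/-- As a continuous linear map, `invDilation hw = w⁻¹ • id`. [folklore] -/
theorem coe_invDilation_eq {w : ℝ} (hw : w ≠ 0) :
    ((invDilation hw : V ≃L[ℝ] V) : V →L[ℝ] V) = w⁻¹ • ContinuousLinearMap.id ℝ V := by
  ext y; simp

/-- **Continuity of the scaled kernel in the scale**: `w ↦ N_w` is continuous `(0, ∞) → 𝒮`. [folklore] -/
theorem continuousOn_scaleKernel (N : 𝓢(V, ℂ)) : ContinuousOn (fun w : ℝ => scaleKernel w N) (Ioi 0) := by
  rw [continuousOn_iff_continuous_restrict]
  have hΦ : Continuous fun w : Ioi (0 : ℝ) => ((invDilation (mem_Ioi.1 w.2).ne' : V ≃L[ℝ] V) : V →L[ℝ] V) := by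
    simp only [coe_invDilation_eq]
    exact (continuous_subtype_val.inv₀ fun w => (mem_Ioi.1 w.2).ne').smul continuous_const
  have hc := SchwartzMap.continuous_compCLMOfContinuousLinearEquiv_apply ℂ _ hΦ N
  have hs : Continuous fun w : Ioi (0 : ℝ) => ((w.1 ^ finrank ℝ V)⁻¹ : ℝ) :=
    (continuous_subtype_val.pow _).inv₀ fun w => (pow_pos (mem_Ioi.1 w.2) _).ne'
  refine (hs.smul hc).congr fun w => ?_
  have hw : (w : ℝ) ≠ 0 := (mem_Ioi.1 w.2).ne'
  simp only [Pi.smul_apply', restrict_apply, scaleKernel, dif_neg hw]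

end Scale

/-! ### Continuity of the tensor product in the profiles -/

section TensorContinuity

variable {D E₁ E₂ : Type*} [NormedAddCommGroup D] [NormedSpace ℝ D] [NormedAddCommGroup E₁] [NormedSpace ℝ E₁]
  [NormedAddCommGroup E₂] [NormedSpace ℝ E₂]

/-- **Joint continuity of `mulComp`**: if `P → F` and `Q → G` in `𝒮` along a filter, then
`mulComp P Q → mulComp F G` (bilinearity, `seminorm_mulComp_le`, continuity of `mulCompBound`). [folklore] -/
theorem tendsto_mulComp {α : Type*} {l : Filter α} (π₁ : D →L[ℝ] E₁) (π₂ : D →L[ℝ] E₂)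
    (h : ∃ C₀ : ℝ, ∀ x, ‖x‖ ≤ C₀ * max ‖π₁ x‖ ‖π₂ x‖)
    {P : α → 𝓢(E₁, ℂ)} {Q : α → 𝓢(E₂, ℂ)} {F : 𝓢(E₁, ℂ)} {G : 𝓢(E₂, ℂ)}
    (hP : Tendsto P l (𝓝 F)) (hQ : Tendsto Q l (𝓝 G)) :
    Tendsto (fun a => SchwartzMap.mulComp (P a) (Q a) π₁ π₂ h) l (𝓝 (SchwartzMap.mulComp F G π₁ π₂ h)) := by
  have hC := h.choose_spec
  set C₀ := h.choose
  rw [(schwartz_withSeminorms ℂ D ℂ).tendsto_nhds]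
  rintro ⟨k, l'⟩ ε hε
  have hP0 : Tendsto (fun a => P a - F) l (𝓝 0) := tendsto_sub_nhds_zero_iff.2 hP
  have hQ0 : Tendsto (fun a => Q a - G) l (𝓝 0) := tendsto_sub_nhds_zero_iff.2 hQ
  have hB₁ : Tendsto (fun a => SchwartzMap.mulCompBound π₁ π₂ C₀ k l' (P a - F) (Q a)) l (𝓝 0) := by
    have h := ((SchwartzMap.continuous_mulCompBound (𝕜 := ℂ) π₁ π₂ C₀ k l').tendsto ((0 : 𝓢(E₁, ℂ)), G)).comp
      (hP0.prodMk_nhds hQ)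
    simpa [Function.comp_def] using h
  have hB₂ : Tendsto (fun a => SchwartzMap.mulCompBound π₁ π₂ C₀ k l' F (Q a - G)) l (𝓝 0) := by
    have h := ((SchwartzMap.continuous_mulCompBound (𝕜 := ℂ) π₁ π₂ C₀ k l').tendsto (F, (0 : 𝓢(E₂, ℂ)))).comp
      (tendsto_const_nhds.prodMk_nhds hQ0)
    simpa [Function.comp_def] using h
  have hle : ∀ a, schwartzSeminormFamily ℂ D ℂ (k, l')
      (SchwartzMap.mulComp (P a) (Q a) π₁ π₂ h - SchwartzMap.mulComp F G π₁ π₂ h) ≤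
        SchwartzMap.mulCompBound π₁ π₂ C₀ k l' (P a - F) (Q a) + SchwartzMap.mulCompBound π₁ π₂ C₀ k l' F (Q a - G) := by
    intro a
    have hdec : SchwartzMap.mulComp (P a) (Q a) π₁ π₂ h - SchwartzMap.mulComp F G π₁ π₂ h =
        SchwartzMap.mulComp (P a - F) (Q a) π₁ π₂ h + SchwartzMap.mulComp F (Q a - G) π₁ π₂ h := by
      ext x
      simp only [sub_apply, add_apply, SchwartzMap.mulComp_apply]
      ring
    rw [SchwartzMap.schwartzSeminormFamily_apply, hdec]
    exact (map_add_le_add _ _ _).trans (add_le_add (SchwartzMap.seminorm_mulComp_le _ _ _ _ h hC k l')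
      (SchwartzMap.seminorm_mulComp_le _ _ _ _ h hC k l'))
  filter_upwards [(hB₁.add hB₂).eventually (gt_mem_nhds (by simpa using hε))] with a ha
  exact (hle a).trans_lt ha

/-- **Continuity of the tensor product of one-point profiles** `(φⱼ)ⱼ ↦ ⊗ⱼ φⱼ` on `𝒮`. [folklore] -/
theorem continuous_tensorFin {E' : Type*} [NormedAddCommGroup E'] [NormedSpace ℝ E'] :
    ∀ n : ℕ, Continuous fun f : Fin n → 𝓢(E', ℂ) => SchwartzMap.tensorFin n f
  | 0 => by
      simp only [SchwartzMap.tensorFin]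
      exact continuous_const
  | n + 1 => by
      refine continuous_iff_continuousAt.2 fun f => ?_
      have hP : Tendsto (fun f' : Fin (n + 1) → 𝓢(E', ℂ) => SchwartzMap.tensorFin n fun i => f' i.castSucc) (𝓝 f)
          (𝓝 (SchwartzMap.tensorFin n fun i => f i.castSucc)) :=
        ((continuous_tensorFin n).comp (continuous_pi fun i => continuous_apply (Fin.castSucc i))).tendsto f
      have hQ : Tendsto (fun f' : Fin (n + 1) → 𝓢(E', ℂ) => f' (Fin.last n)) (𝓝 f) (𝓝 (f (Fin.last n))) :=
        (continuous_apply (Fin.last n)).tendsto f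
      exact tendsto_mulComp _ _ ⟨1, norm_le_max_castSucc_last⟩ hP hQ

end TensorContinuity

/-! ### Continuity of the skeleton in the profiles and in the scale -/

section SkeletonContinuity

open Literature.Analysis.Distribution

variable (𝔖 : SchwingerFamily (EuclideanSpace ℝ (Fin d))) {k : ℕ}
  (ξ : Fin (k + 1) → EuclideanSpace ℝ (Fin d)) (ê : Fin d → EuclideanSpace ℝ (Fin d))

/-- **Continuity of the skeleton Schwinger function in the profiles.** [folklore] -/
theorem continuous_skelSV_profiles (u : Fin (k + 1) × Fin d → ℝ) :
    Continuous fun φ : Fin (k + 2) → 𝓢(EuclideanSpace ℝ (Fin d), ℂ) => skelSV 𝔖 φ ξ ê u := by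
  unfold skelSV skeletonFnV
  exact (𝔖 (k + 2)).continuous.comp ((SchwartzMap.compSubConstCLM ℂ (posV ξ ê u)).continuous.comp
    (continuous_tensorFin (k + 2)))

/-- **Continuity of the regularised skeleton Schwinger function in the width**: for fixed profiles
`κⱼ`, `w ↦ 𝒮[κ_w](u)` (`κ_w = scaleKernel w κ`) is continuous on `(0, ∞)`. [folklore] -/
theorem continuousOn_skelSV_scaleKernel (κ : Fin (k + 2) → 𝓢(EuclideanSpace ℝ (Fin d), ℂ))
    (u : Fin (k + 1) × Fin d → ℝ) :
    ContinuousOn (fun w : ℝ => skelSV 𝔖 (fun j => scaleKernel w (κ j)) ξ ê u) (Ioi 0) :=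
  (continuous_skelSV_profiles 𝔖 ξ ê u).comp_continuousOn (continuousOn_pi.2 fun j => continuousOn_scaleKernel (κ j))

end SkeletonContinuity

/-! ### Linearity of the explicit constants in the slot constants -/

section Constants

open Literature.Analysis.Complex

/-- `l1TubeBound` is linear in a constant slot constant. [folklore] -/
theorem l1TubeBound_const_mul (a b κ : ℝ) (k : ℕ) (C : ℝ) (N : ℝ → ℕ) (c : ℝ) :
    l1TubeBound a b κ k (fun _ => C) N c = C * l1TubeBound a b κ k (fun _ => 1) N c := by
  unfold l1TubeBound l1TubeDecayConst
  rw [← integral_const_mul C]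
  refine integral_congr_ae (Eventually.of_forall fun p => ?_)
  simp only
  ring

/-- `l1TubeBound` with unit slot constant is nonnegative. [folklore] -/
theorem l1TubeBound_one_nonneg (a b κ : ℝ) (k : ℕ) (N : ℝ → ℕ) (c : ℝ) :
    0 ≤ l1TubeBound a b κ k (fun _ => 1) N c :=
  integral_nonneg fun p => by
    simp only [l1TubeDecayConst, one_mul]
    exact mul_nonneg (mul_nonneg (Real.exp_pos _).le (integral_nonneg fun x => (Real.exp_pos _).le))
      (by positivity)

variable {k : ℕ}

/-- `slotB` is linear in the slot constant. [folklore] -/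
theorem LogSlot.slotB_const_mul (i : Fin (k + 1)) (b c C : ℝ) (N : ℕ) (θ : Fin (k + 1) → ℝ → ℂ) :
    LogSlot.slotB i b (c * C) N θ = c * LogSlot.slotB i b C N θ := by
  simp only [LogSlot.slotB, ← integral_const_mul]
  congr 1; funext u'; ring

/-- `slotB` is nonnegative for a nonnegative slot constant. [folklore] -/
theorem LogSlot.slotB_nonneg (i : Fin (k + 1)) (b : ℝ) {C : ℝ} (hC : 0 ≤ C) (N : ℕ) (θ : Fin (k + 1) → ℝ → ℂ) :
    0 ≤ LogSlot.slotB i b C N θ :=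
  integral_nonneg fun u' => mul_nonneg (Finset.prod_nonneg fun j _ => norm_nonneg _) (by positivity)

end Constants

/-! ### Continuity of the logarithmic functional over a dominated family -/

section LogTFamily

variable {k : ℕ}

/-- **Continuity of `ω ↦ logT (S_ω) b θ`** for a family `S_ω` with a common polynomial bound on
`T ⊆ Ω` and `ω ↦ S_ω(u)` continuous on `T` for every `u` (dominated convergence). [folklore] -/
theorem LogSlot.continuousOn_logT_param {Ω : Type*} [TopologicalSpace Ω] [FirstCountableTopology Ω]
    {S : Ω → (Fin (k + 1) → ℝ) → ℂ} {T : Set Ω} {b : ℝ} (hb : 0 < b) (hSc : ∀ ω ∈ T, Continuous (S ω))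
    {C : ℝ} {N : ℕ} (hSb : ∀ ω ∈ T, ∀ u, ‖S ω u‖ ≤ C * (1 + ‖u‖) ^ N)
    (hcont : ∀ u, ContinuousOn (fun ω => S ω u) T) (θ : Fin (k + 1) → 𝓢(ℝ, ℂ)) :
    ContinuousOn (fun ω => LogSlot.logT (S ω) b fun j => ⇑(θ j)) T := by
  unfold LogSlot.logT
  have hBc : Continuous fun u : Fin (k + 1) → ℝ => (((C * (1 + ‖u‖) ^ N : ℝ)) : ℂ) :=
    Complex.continuous_ofReal.comp (continuous_const.mul ((continuous_const.add continuous_norm).pow N))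
  have hBb : ∀ u : Fin (k + 1) → ℝ, ‖(((C * (1 + ‖u‖) ^ N : ℝ)) : ℂ)‖ ≤ |C| * (1 + ‖u‖) ^ N := fun u => by
    rw [Complex.norm_real, Real.norm_eq_abs, abs_mul, abs_of_nonneg (by positivity : (0 : ℝ) ≤ (1 + ‖u‖) ^ N)]
  have hint := (LogSlot.integrable_wprod_mul hb hBc hBb θ).norm
  refine continuousOn_of_dominated (bound := fun u => ‖wprod b (fun j => ⇑(θ j)) u * (((C * (1 + ‖u‖) ^ N : ℝ)) : ℂ)‖)
    (fun ω hω => (LogSlot.integrable_wprod_mul hb (hSc ω hω) (hSb ω hω) θ).aestronglyMeasurable)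
    (fun ω hω => Eventually.of_forall fun u => ?_) hint
    (Eventually.of_forall fun u => continuousOn_const.mul (hcont u))
  rw [norm_mul, norm_mul, Complex.norm_real, Real.norm_eq_abs]
  exact mul_le_mul_of_nonneg_left ((hSb ω hω u).trans (le_abs_self _)) (norm_nonneg _)

end LogTFamily

end Literature.MathematicalPhysics.QuantumFieldTheory
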